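import Mathlib
import HarnessLib
import Summits.HubbardSuperconductivity.HubbardSuperconductivity.Theorems.KLProgrammeKLRegimeEngineOverlapMeanFreePieceRows
import Summits.HubbardSuperconductivity.HubbardSuperconductivity.Theorems.KLProgrammeKLRegimeOverlapWtMeanFreeBaseDoors
import Summits.HubbardSuperconductivity.HubbardSuperconductivity.Theorems.KLProgrammeKLRegimeSectorMultiplierOverlapWt

/-!
# K3 ENGINE child (stmt-HubbardSuperconductivity-20437), stub (b) (ℓ)/(I1′) below the deep window — the W2 (OVERLAP) twin of (D5), brick (W4):
# the WEIGHTED overlap rows AND full columns of `E(F_{k+1}[K♯_n])·S(F̃_k[K♯_n])` AT THE FINAL MEAN-FREE FLOW FRAME `K♯_n = K_n ⊖ 0`, from the base index `m₀`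

Cell `gate-hubbard-kl`, seat hubbard-kl-k3c3-p2 (g12); F1-W2-DESIGN §2 (W4).  p3's base at the mean-free base frame `K♯_{m₀}`
(`overlapWt_jump_sums_klEng10_meanFreeBase`, …OverlapWtMeanFreeBaseDoors: rows `≤ 81·C_J·M/β`, per-pair sums `≤ 3·C_J·M/β`, window `4^{m₀}·U ≤ 4^{2(k+1)+d′}`;
full columns by the fine-side count `card_overlap_klAniso_bgmFat_fine_le` and `colSum_wt_sectorAnalysis_mul_sectorSub_le`) plus the telescope along the mean-free
chain `K♯_i`, `m₀ ≤ i ≤ n` (per piece (W3) `rowColSumWt_overlap_sub_meanFree`: rows `≤ (M/β)(Φ₁4^{k+1}/4^i + Φ₂)G₀`, columns `≤ 2×`; rectangular chain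
bookkeeping `rowSumWt_norm_rchain_le`/`colSumWt_norm_rchain_le`), summed with `Σ_{i≥m₀} 4^{k+1}/4^i ≤ 4/3` and `(n − m₀)·U² ≤ cc/log 4 ≤ 1` (`IsKLRegime`):

* `rowSumWt_norm_rchain_le`, `colSumWt_norm_rchain_le` — weighted rows/columns of a RECTANGULAR matrix chain from per-step bounds;
* **`overlapWt_rows_cols_klEng_meanFreeFinal (d′) (R) (c″)`** — `∃ C_J > 0`: stub-(b) binders + `c″U ≤ 1`, `IsKLRegime U cc (−n)`, `HistP … 0 n`, the REGISTERED (K5′) clauses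
  `∀ m, 1 ≤ m → m < n → FlowPieceOscAt … c″ … m`, a base index `1 ≤ m₀ ≤ n` with `2(k+1)+5 ≤ m₀` and `4^{m₀}·U ≤ 4^{2(k+1)+d′}`: the `klScaleWt (k+1)`-weighted rows of
  `E(F_{k+1}[K♯_n])·S(F̃_k[K♯_n])` are `≤ 81·C_J·M/β` and its FULL columns `≤ 162·C_J·M/β` (`C_J = C_J^{base}(d′) + (c″+Gfr₁+Gfr₂+Gfr₃+1)(4Φ₁/3 + Φ₂)/81`).

The constant depends on `(R, c″)` only through the explicit factor `c″ + Gfr₁ + Gfr₂ + Gfr₃ + 1` of the x-free telescope part (absorbed by `U₀(R)` in §C).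
No definitions, no sorry.  Nothing asserts any stub, K3 or superconductivity. [cite: BenfattoGiulianiMastropietro2006, §2.7 (2.71a), §2.8 (2.77), (2.82)–(2.83), §3 (3.2)–(3.8)]
-/

noncomputable section

namespace Summit.HubbardSuperconductivity.HubbardSuperconductivity.Theorems.TorusFourierL2

set_option linter.dupNamespace false -- summit = problem name (single-conjunct summit), D-0017

open Set Finset Literature.MathematicalPhysics.QuantumLattice Literature.MathematicalPhysics.QuantumLattice.BandSectorCounting
open Literature.MathematicalPhysics.QuantumLattice.FermiRG Literature.Probability.LatticeModels Literature.Analysis.SpecialFunctions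
open Summit.HubbardSuperconductivity.HubbardSuperconductivity.Theorems.DispersionFlow
open Summit.HubbardSuperconductivity.HubbardSuperconductivity.Theorems.KLRegimeSplit
open Summit.HubbardSuperconductivity.HubbardSuperconductivity.Theorems.KLProgrammeLegKernels
open Summit.HubbardSuperconductivity.HubbardSuperconductivity.Theorems.PerturbedFermiCurve
open Summit.HubbardSuperconductivity.HubbardSuperconductivity.Theorems.EngineV8
open Summit.HubbardSuperconductivity.HubbardSuperconductivity.Theorems.TwoVolumeSource
open Literature.Probability.LatticeModels.BattleFederbush
open scoped Real Nat

open Classical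

/-! ## §1 Weighted rows and columns of a rectangular matrix chain -/

section Chain

variable {γ α : Type*} [Fintype γ] [Fintype α]

omit [Fintype γ] in
/-- **Weighted rows along a rectangular chain from per-step bounds**: `rows(A(m₀+d)) ≤ rows(A m₀) + Σ_{j<d} b_j` if
`rows(A(m₀+j+1) − A(m₀+j)) ≤ b_j` (`w ≥ 0`). [folklore] -/
theorem rowSumWt_norm_rchain_le (A : ℕ → Matrix γ α ℂ) (w : γ → α → ℝ) (hw : ∀ x y, 0 ≤ w x y) (m₀ d : ℕ) (x : γ) (bnd : ℕ → ℝ)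
    (hbnd : ∀ j < d, ∑ y, ‖(A (m₀ + j + 1) - A (m₀ + j)) x y‖ * w x y ≤ bnd j) :
    ∑ y, ‖A (m₀ + d) x y‖ * w x y ≤ ∑ y, ‖A m₀ x y‖ * w x y + ∑ j ∈ range d, bnd j := by
  induction d with
  | zero => simp
  | succ d ih =>
    have hstep : ∑ y, ‖A (m₀ + (d + 1)) x y‖ * w x y ≤ ∑ y, ‖A (m₀ + d) x y‖ * w x y + ∑ y, ‖(A (m₀ + d + 1) - A (m₀ + d)) x y‖ * w x y := by
      rw [← Finset.sum_add_distrib]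
      refine Finset.sum_le_sum fun y _ => ?_
      rw [← add_mul]
      refine mul_le_mul_of_nonneg_right ?_ (hw x y)
      have e : A (m₀ + (d + 1)) x y = A (m₀ + d) x y + (A (m₀ + d + 1) - A (m₀ + d)) x y := by
        rw [Matrix.sub_apply, show m₀ + (d + 1) = m₀ + d + 1 by omega]; ring
      rw [e]; exact norm_add_le _ _
    have h1 := ih (fun j hj => hbnd j (by omega))
    have h2 := hbnd d (by omega)
    rw [Finset.sum_range_succ]
    linarith

omit [Fintype α] in
/-- **Weighted columns along a rectangular chain from per-step bounds**. [folklore] -/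
theorem colSumWt_norm_rchain_le (A : ℕ → Matrix γ α ℂ) (w : γ → α → ℝ) (hw : ∀ x y, 0 ≤ w x y) (m₀ d : ℕ) (y : α) (bnd : ℕ → ℝ)
    (hbnd : ∀ j < d, ∑ x, ‖(A (m₀ + j + 1) - A (m₀ + j)) x y‖ * w x y ≤ bnd j) :
    ∑ x, ‖A (m₀ + d) x y‖ * w x y ≤ ∑ x, ‖A m₀ x y‖ * w x y + ∑ j ∈ range d, bnd j := by
  induction d with
  | zero => simp
  | succ d ih =>
    have hstep : ∑ x, ‖A (m₀ + (d + 1)) x y‖ * w x y ≤ ∑ x, ‖A (m₀ + d) x y‖ * w x y + ∑ x, ‖(A (m₀ + d + 1) - A (m₀ + d)) x y‖ * w x y := by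
      rw [← Finset.sum_add_distrib]
      refine Finset.sum_le_sum fun x _ => ?_
      rw [← add_mul]
      refine mul_le_mul_of_nonneg_right ?_ (hw x y)
      have e : A (m₀ + (d + 1)) x y = A (m₀ + d) x y + (A (m₀ + d + 1) - A (m₀ + d)) x y := by
        rw [Matrix.sub_apply, show m₀ + (d + 1) = m₀ + d + 1 by omega]; ring
      rw [e]; exact norm_add_le _ _
    have h1 := ih (fun j hj => hbnd j (by omega))
    have h2 := hbnd d (by omega)
    rw [Finset.sum_range_succ]
    linarith

omit [Fintype γ] [Fintype α] in
/-- The geometric sum of the telescope's `x`-decaying part: `Σ_{j<d} 4^{k+1}/4^{m₀+j} ≤ 4/3` for `k + 1 ≤ m₀`. [folklore] -/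
theorem sum_four_pow_div_le {k m₀ : ℕ} (hkm : k + 1 ≤ m₀) (d : ℕ) :
    ∑ j ∈ range d, (4 : ℝ) ^ (k + 1) / (4 : ℝ) ^ (m₀ + j) ≤ 4 / 3 := by
  have hterm : ∀ j : ℕ, (4 : ℝ) ^ (k + 1) / (4 : ℝ) ^ (m₀ + j) ≤ ((1 : ℝ) / 4) ^ j := by
    intro j
    have h1 : (4 : ℝ) ^ (k + 1) ≤ (4 : ℝ) ^ m₀ := pow_le_pow_right₀ (by norm_num) hkm
    calc (4 : ℝ) ^ (k + 1) / (4 : ℝ) ^ (m₀ + j) ≤ (4 : ℝ) ^ m₀ / (4 : ℝ) ^ (m₀ + j) := div_le_div_of_nonneg_right h1 (by positivity)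
      _ = ((1 : ℝ) / 4) ^ j := by rw [pow_add, one_div_pow]; field_simp
  refine (Finset.sum_le_sum fun j _ => hterm j).trans ?_
  have hgeom : ∀ d : ℕ, ∑ j ∈ range d, ((1 : ℝ) / 4) ^ j ≤ 4 / 3 := by
    intro d
    rw [geom_sum_eq (by norm_num) d]
    have h1 : (0 : ℝ) ≤ ((1 : ℝ) / 4) ^ d := by positivity
    have e : (((1 : ℝ) / 4) ^ d - 1) / ((1 : ℝ) / 4 - 1) = (4 / 3) * (1 - ((1 : ℝ) / 4) ^ d) := by field_simp; ring
    rw [e]; nlinarith only [h1]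
  exact hgeom d

end Chain

/-! ## §2 The weighted overlap rows and full columns at the final mean-free flow frame -/

set_option maxHeartbeats 4000000 in
/-- **Weighted overlap rows and FULL columns of `E(F_{k+1}[K♯_n])·S(F̃_k[K♯_n])` at the final mean-free flow frame** (see the module docstring): p3's base at
`K♯_{m₀}` plus the (W3) pieces along the mean-free chain, `(n − m₀)U² ≤ 1` in the KL regime.
[cite: BenfattoGiulianiMastropietro2006, §2.7 (2.71a), §2.8 (2.77), (2.82)–(2.83), §3 (3.2)–(3.8)] -/
theorem overlapWt_rows_cols_klEng_meanFreeFinal (dd : ℕ) (R : RenConsts) (c'' : ℝ) (hc'' : 0 ≤ c'') :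
    ∃ CJ : ℝ, 0 < CJ ∧
      ∀ (G : GeoConsts) (P : SplitConsts) (Q : EngConsts) (cc : ℝ), R.WF2 → 0 < cc → cc ≤ EngineV8.klEngC₃6 P R →
      ∀ μ ∈ klWindowC, ∀ U : ℝ, 0 < U → U ≤ min (EngineV8.klEngU₀3 P R cc) (1 / (R.Gfr 3 + 1)) → c'' * U ≤ 1 →
      ∀ β : ℝ, klBetaMin ≤ β → β ≤ Real.exp (cc / U ^ 2) →
      ∀ (L M : ℕ) [NeZero L] [NeZero M], EngineV8.klEngL₃ β U ≤ L → EngineV8.klEngM₃ β U L ≤ M →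
      ∀ n : ℕ, n ≤ nScales β + 1 → IsKLRegime U cc (-(n : ℤ)) → HistP klPredsV17F2 L M G P Q R β U μ 0 n →
        (∀ m, 1 ≤ m → m < n → FlowPieceOscAt L M c'' β U μ m) →
        ∀ m₀ : ℕ, 1 ≤ m₀ → m₀ ≤ n → ∀ k : ℕ, 2 * (k + 1) + 5 ≤ m₀ → (4 : ℝ) ^ m₀ * U ≤ (4 : ℝ) ^ (2 * (k + 1) + dd) →
        (∀ X'' : SpaceTimeIdx L M × SectorLeg (sectorCount (k + 1)),
          ∑ X' : SpaceTimeIdx L M × SectorLeg (sectorCount k),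
            ‖(sectorAnalysisMatrix L M β (klAnisoFamily L M β μ (fsub (klFlowFrameU L M β U μ n) (symInterp L fun _ =>
                ∑ m ∈ Ico n n, klAngularMean (klLocalPart L M β U μ (klFlowFrameU L M β U μ m) m))) klE0 (k + 1)) *
              sectorSubMatrix L M β (bgmFatMultiplier L M klE0 β (nambuXiCT L μ (fsub (klFlowFrameU L M β U μ n) (symInterp L fun _ =>
                ∑ m ∈ Ico n n, klAngularMean (klLocalPart L M β U μ (klFlowFrameU L M β U μ m) m)))) k)) X'' X'‖ *
              EngineV8.klScaleWt L M β (k + 1) {EngineV8.latticeLegPos (2 * (2 * M)) X'', EngineV8.latticeLegPos (2 * (2 * M)) X'} ≤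
            81 * CJ * M / β) ∧
        (∀ X' : SpaceTimeIdx L M × SectorLeg (sectorCount k),
          ∑ X'' : SpaceTimeIdx L M × SectorLeg (sectorCount (k + 1)),
            ‖(sectorAnalysisMatrix L M β (klAnisoFamily L M β μ (fsub (klFlowFrameU L M β U μ n) (symInterp L fun _ =>
                ∑ m ∈ Ico n n, klAngularMean (klLocalPart L M β U μ (klFlowFrameU L M β U μ m) m))) klE0 (k + 1)) *
              sectorSubMatrix L M β (bgmFatMultiplier L M klE0 β (nambuXiCT L μ (fsub (klFlowFrameU L M β U μ n) (symInterp L fun _ =>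
                ∑ m ∈ Ico n n, klAngularMean (klLocalPart L M β U μ (klFlowFrameU L M β U μ m) m)))) k)) X'' X'‖ *
              EngineV8.klScaleWt L M β (k + 1) {EngineV8.latticeLegPos (2 * (2 * M)) X'', EngineV8.latticeLegPos (2 * (2 * M)) X'} ≤
            162 * CJ * M / β) := by
  have he : (0 : ℝ) < klE0 := by norm_num [klE0]
  obtain ⟨CJb, hCJb, hbase⟩ := overlapWt_jump_sums_klEng10_meanFreeBase dd
  obtain ⟨Φ₁, Φ₂, hΦ₁, hΦ₂, hpiece⟩ := rowColSumWt_overlap_sub_meanFree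
  set Γ : ℝ := |c''| + |R.Gfr 1| + |R.Gfr 2| + |R.Gfr 3| + 1 with hΓ
  have hΓ0 : 0 < Γ := by rw [hΓ]; positivity
  refine ⟨CJb + Γ * (4 * Φ₁ / 3 + Φ₂) / 81, by positivity, ?_⟩
  intro G P Q cc hR2 hcc hcc6 μ hμ U hU hUle hcU β hβmin hβc L M _ _ hL3 hM3 n hnN hreg hhist hosc m₀ hm1 hmn k hkm hwin
  have hRj : ∀ j, 0 ≤ R.Gfr j := EngineV8.gfr_nonneg_of_wf2 hR2
  have hβ0 : 0 < β := pos_of_klBetaMin_le hβmin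
  have hM0 : (0 : ℝ) < M := Nat.cast_pos.2 (Nat.pos_of_ne_zero (NeZero.ne M))
  have hβne : β ≠ 0 := hβ0.ne'
  have hMne : (M : ℝ) ≠ 0 := hM0.ne'
  have hΓeq : Γ = c'' + R.Gfr 1 + R.Gfr 2 + R.Gfr 3 + 1 := by
    rw [hΓ, abs_of_nonneg hc'', abs_of_nonneg (hRj 1), abs_of_nonneg (hRj 2), abs_of_nonneg (hRj 3)]
  -- doors: `U ≤ 1`, `cc ≤ 1`, hence `G₀ ≤ 2Γ·…` and `(n − m₀)U² ≤ 1`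
  have ha : (-4 : ℝ) < -(6 / 5) := by norm_num
  have hab : (-(6 / 5) : ℝ) ≤ -(1 / 10) := by norm_num
  have hb : (-(1 / 10) : ℝ) < 0 := by norm_num
  have hcle := (hcc6.trans (EngineV8.klEngC₃6_le_klEngC₃3 P R)).trans (EngineV8.klEngC₃3_le_symbolC₃ ha hab hb P hRj)
  have hcc1 : cc ≤ 1 := by
    refine hcle.trans ?_
    have hG2 : 0 < 12 * (R.Gfr 2 + 1) := by have := hRj 2; positivity
    rw [div_le_one hG2]
    have hk : min (min ((bandBounds ha hab hb).Dtmin / 4) ((bandBounds ha hab hb).rhomin / 4)) (1 / 40) ≤ 1 / 40 := min_le_right _ _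
    nlinarith [hk, hRj 2]
  have hU1 : U ≤ 1 := ((hUle.trans (min_le_left _ _)).trans (EngineV8.klEngU₀3_le_symbolU₀ ha hab hb P hRj cc)).trans (min_le_left _ _)
  have hlog : 1 ≤ Real.log 4 := by
    have h4 : Real.exp 1 ≤ 4 := by have := Real.exp_one_lt_d9; norm_num at this; linarith
    calc (1 : ℝ) = Real.log (Real.exp 1) := (Real.log_exp 1).symm
      _ ≤ Real.log 4 := Real.log_le_log (Real.exp_pos 1) h4
  have hdnU : ((n - m₀ : ℕ) : ℝ) * U ^ 2 ≤ 1 := by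
    have hr : U ^ 2 * |((-(n : ℤ) : ℤ) : ℝ)| * Real.log 4 ≤ cc := hreg
    rw [show |((-(n : ℤ) : ℤ) : ℝ)| = (n : ℝ) by push_cast; rw [abs_neg]; exact abs_of_nonneg (Nat.cast_nonneg n)] at hr
    have hdn : ((n - m₀ : ℕ) : ℝ) ≤ (n : ℝ) := by exact_mod_cast Nat.sub_le n m₀
    have h1 : (n : ℝ) * U ^ 2 ≤ (n : ℝ) * U ^ 2 * Real.log 4 := le_mul_of_one_le_right (by positivity) hlog
    nlinarith [hdn, h1, hr, hcc1, sq_nonneg U]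
  set G₀ : ℝ := (c'' + R.Gfr 1 + R.Gfr 2 + R.Gfr 3 + 1) * U ^ 2 with hG₀def
  have hG₀Γ : G₀ = Γ * U ^ 2 := by rw [hG₀def, hΓeq]
  have hG₀0 : 0 ≤ G₀ := by rw [hG₀Γ]; positivity
  have hU21 : U ^ 2 ≤ 1 := by nlinarith only [hU, hU1]
  have hG₀le : G₀ ≤ Γ := by rw [hG₀Γ]; nlinarith only [hΓ0, hU21]
  have hdG₀ : ((n - m₀ : ℕ) : ℝ) * G₀ ≤ Γ := by
    rw [hG₀Γ]
    calc ((n - m₀ : ℕ) : ℝ) * (Γ * U ^ 2) = Γ * (((n - m₀ : ℕ) : ℝ) * U ^ 2) := by ring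
      _ ≤ Γ * 1 := mul_le_mul_of_nonneg_left hdnU hΓ0.le
      _ = Γ := mul_one _
  -- the chain, its weight, the per-piece bounds
  set Kc : ℕ → TrigPolyC4v := fun i => fsub (klFlowFrameU L M β U μ i) (symInterp L fun _ =>
    ∑ m ∈ Ico i n, klAngularMean (klLocalPart L M β U μ (klFlowFrameU L M β U μ m) m)) with hKc
  set O : ℕ → Matrix (SpaceTimeIdx L M × SectorLeg (sectorCount (k + 1))) (SpaceTimeIdx L M × SectorLeg (sectorCount k)) ℂ := fun i =>
    sectorAnalysisMatrix L M β (klAnisoFamily L M β μ (Kc i) klE0 (k + 1)) *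
      sectorSubMatrix L M β (bgmFatMultiplier L M klE0 β (nambuXiCT L μ (Kc i)) k) with hO
  set w : SpaceTimeIdx L M × SectorLeg (sectorCount (k + 1)) → SpaceTimeIdx L M × SectorLeg (sectorCount k) → ℝ := fun X'' X' =>
    EngineV8.klScaleWt L M β (k + 1) {EngineV8.latticeLegPos (2 * (2 * M)) X'', EngineV8.latticeLegPos (2 * (2 * M)) X'} with hwdef
  have hw0 : ∀ X'' X', 0 ≤ w X'' X' := by
    intro X'' X'
    rw [hwdef]; dsimp only
    rw [klScaleWt_apply]
    have := labelDiam_nonneg (gridLabelDist L (2 * (2 * M)) β) {EngineV8.latticeLegPos (2 * (2 * M)) X'', EngineV8.latticeLegPos (2 * (2 * M)) X'}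
    have := (klth_klScale_pos (k + 1)).le; positivity
  have hstep : ∀ j < n - m₀,
      (∀ X'', ∑ X', ‖(O (m₀ + j + 1) - O (m₀ + j)) X'' X'‖ * w X'' X' ≤ ((M : ℝ) / β) * ((Φ₁ * (4 : ℝ) ^ (k + 1) / (4 : ℝ) ^ (m₀ + j) + Φ₂) * G₀)) ∧
      (∀ X', ∑ X'', ‖(O (m₀ + j + 1) - O (m₀ + j)) X'' X'‖ * w X'' X' ≤ 2 * (((M : ℝ) / β) * ((Φ₁ * (4 : ℝ) ^ (k + 1) / (4 : ℝ) ^ (m₀ + j) + Φ₂) * G₀))) := by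
    intro j hj
    have h := hpiece G P R Q cc hR2 hcc hcc6 μ hμ U hU hUle c'' hc'' hcU β hβmin hβc L M hL3 hM3 n hnN hreg hhist hosc L hL3 k (m₀ + j)
      (by omega) (by omega)
    simpa only [hO, hKc, hwdef, hG₀def] using h
  -- the base at `K♯_{m₀}`: rows and per-pair columns, then full columns by the fine-side count
  obtain ⟨hrow0, hcolpair0, -⟩ := hbase G P R Q cc hR2 hcc hcc6 μ hμ U hU hUle β hβmin hβc L M hL3 hM3 n hnN hreg hhist m₀ hm1 hmn k (k + 1)
    le_rfl (by omega) hwin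
  have hrow0' : ∀ X'', ∑ X', ‖O m₀ X'' X'‖ * w X'' X' ≤ 81 * CJb * M / β := fun X'' => by
    simpa only [hO, hKc, hwdef] using hrow0 X''
  have hcol0' : ∀ X', ∑ X'', ‖O m₀ X'' X'‖ * w X'' X' ≤ ((27 * 2 ^ (k + 1 - k) : ℕ) : ℝ) * (3 * CJb * M / β) := by
    intro X'
    have h := colSum_wt_sectorAnalysis_mul_sectorSub_le β _ _
      (fun ω => card_overlap_klAniso_bgmFat_fine_le he β μ (Kc m₀) (show k ≤ k + 1 by omega) ω) w
      (by positivity : (0 : ℝ) ≤ 3 * CJb * M / β) (fun ω' ω σ c x => by simpa only [hKc, hwdef] using hcolpair0 ω' ω σ c x) X'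
    simpa only [hO] using h
  -- the telescope sums
  have hsum : ∑ j ∈ range (n - m₀), ((M : ℝ) / β) * ((Φ₁ * (4 : ℝ) ^ (k + 1) / (4 : ℝ) ^ (m₀ + j) + Φ₂) * G₀) ≤ ((M : ℝ) / β) * (Γ * (4 * Φ₁ / 3 + Φ₂)) := by
    rw [← Finset.mul_sum]
    refine mul_le_mul_of_nonneg_left ?_ (by positivity)
    have e1 : ∑ j ∈ range (n - m₀), (Φ₁ * (4 : ℝ) ^ (k + 1) / (4 : ℝ) ^ (m₀ + j) + Φ₂) * G₀ =
        ∑ j ∈ range (n - m₀), (Φ₁ * G₀ * ((4 : ℝ) ^ (k + 1) / (4 : ℝ) ^ (m₀ + j)) + Φ₂ * G₀) := Finset.sum_congr rfl fun j _ => by ring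
    rw [e1, Finset.sum_add_distrib, ← Finset.mul_sum, Finset.sum_const, Finset.card_range, nsmul_eq_mul]
    have hs := sum_four_pow_div_le (show k + 1 ≤ m₀ by omega) (n - m₀)
    have t1 : Φ₁ * G₀ * ∑ j ∈ range (n - m₀), (4 : ℝ) ^ (k + 1) / (4 : ℝ) ^ (m₀ + j) ≤ Φ₁ * G₀ * (4 / 3) := mul_le_mul_of_nonneg_left hs (by positivity)
    have t2 : Φ₁ * G₀ * (4 / 3) ≤ Φ₁ * Γ * (4 / 3) := by nlinarith only [hG₀le, hΦ₁]
    have t3 : ((n - m₀ : ℕ) : ℝ) * (Φ₂ * G₀) = Φ₂ * (((n - m₀ : ℕ) : ℝ) * G₀) := by ring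
    have t4 : Φ₂ * (((n - m₀ : ℕ) : ℝ) * G₀) ≤ Φ₂ * Γ := mul_le_mul_of_nonneg_left hdG₀ hΦ₂.le
    nlinarith only [t1, t2, t3, t4]
  have hsum2 : ∑ j ∈ range (n - m₀), 2 * (((M : ℝ) / β) * ((Φ₁ * (4 : ℝ) ^ (k + 1) / (4 : ℝ) ^ (m₀ + j) + Φ₂) * G₀)) ≤ 2 * (((M : ℝ) / β) * (Γ * (4 * Φ₁ / 3 + Φ₂))) := by
    rw [← Finset.mul_sum]; exact mul_le_mul_of_nonneg_left hsum (by norm_num)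
  have hMβ0 : 0 ≤ (M : ℝ) / β := by positivity
  refine ⟨fun X'' => ?_, fun X' => ?_⟩
  · have hchain := rowSumWt_norm_rchain_le O w hw0 m₀ (n - m₀) X''
      (fun j => ((M : ℝ) / β) * ((Φ₁ * (4 : ℝ) ^ (k + 1) / (4 : ℝ) ^ (m₀ + j) + Φ₂) * G₀)) (fun j hj => (hstep j hj).1 X'')
    rw [show m₀ + (n - m₀) = n by omega] at hchain
    have hfin : ∑ X', ‖O n X'' X'‖ * w X'' X' ≤ 81 * (CJb + Γ * (4 * Φ₁ / 3 + Φ₂) / 81) * M / β := by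
      have := (hchain.trans (add_le_add (hrow0' X'') hsum))
      refine this.trans (le_of_eq ?_)
      field_simp
    simpa only [hO, hKc, hwdef] using hfin
  · have hchain := colSumWt_norm_rchain_le O w hw0 m₀ (n - m₀) X'
      (fun j => 2 * (((M : ℝ) / β) * ((Φ₁ * (4 : ℝ) ^ (k + 1) / (4 : ℝ) ^ (m₀ + j) + Φ₂) * G₀))) (fun j hj => (hstep j hj).2 X')
    rw [show m₀ + (n - m₀) = n by omega] at hchain
    have hfin : ∑ X'', ‖O n X'' X'‖ * w X'' X' ≤ 162 * (CJb + Γ * (4 * Φ₁ / 3 + Φ₂) / 81) * M / β := by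
      have := (hchain.trans (add_le_add (hcol0' X') hsum2))
      refine this.trans (le_of_eq ?_)
      rw [show k + 1 - k = 1 by omega]
      push_cast
      field_simp
      ring
    simpa only [hO, hKc, hwdef] using hfin

end Summit.HubbardSuperconductivity.HubbardSuperconductivity.Theorems.TorusFourierL2

end
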